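import Mathlib
import Literature.MathematicalPhysics.QuantumLattice.DWaveOrderParameterProofs

/-!
# Triage scratch — triager k=2 (gen 2), round 1, crux `WcbcsBcsConstruction` (stmt-HubbardSuperconductivity-2010)

Three cheap checks used in `TRIAGE-r1-2.md` (all sorry-free):

(A) `staircase_pointwise`: the crux's order clause is a conjunction of per-`h` stair floors and a floor on
    any ONE stair bounds the order parameter from ABOVE only — both directions are the landed levers
    (`dWaveOrderParameter_le_liminf`, `le_dWaveOrderParameter_of_forall`, p68681).  Used against every
    "top/middle stair" deliverable (weyl-envelope-cooper-flow, source-staircase-nambu-dirac, nodal-dirac-source-wedge).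

(B) `b1g_orthogonal_swap`: on the `L × L` momentum torus, any summand of the form
    `(c k₁ - c k₂) · f (c k₁ + c k₂) ((c k₁ - c k₂)²)` sums to zero (involution `k ↦ k.swap`).  With
    `c i = cos (2π i / L)`, `f ξ' d = h / (2 √((ξ'·(-2) - μ)² + 8 h² d))` this is
    `Σ_k ĝ_k · h / (2 E_k) = 0`, i.e. the ON-SITE (s-wave) anomalous average of the `d`-wave–sourced free
    gas vanishes identically at every finite `L`: the bare repulsive `U` produces NO first-order anomalous
    self-energy in the sourced Hartree–Fock–Bogoliubov theory ("bare U is B₁g-orthogonal" in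
    gap-inequality-bootstrap; compatible with Barriers.GeneralizedHartreeFockNoPairing).  So the sourced
    response is unsuppressed at O(U): `F_U(h) = M⁰_{μ-Un/2}(h) + O(U²)`, and the sign of the O(U²)
    B₁g kernel (support item 0158) is the first place the interaction is felt.

(C) `sci_iff_shifted_floor`: the "self-consistency inequality" (SCI) `x ≥ η·M(h + g·x)` with `M`
    monotone is, for each fixed `h`, upward-closed in `x` once it holds at some `x₀` with slope
    condition — here only the elementary half used in the triage: SCI at `x`, `x ≤ x'`, and the
    one-sided Lipschitz bound `η·(M(h+g x') - M(h+g x)) ≤ x' - x` give SCI at `x'`.  (Triager 1's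
    `SciCostume.lean` has the quantitative two-sided version; this is the order-theoretic core: SCI is a
    per-stair half-line condition `F(h) ≥ x_h`, not a fixed-point problem.)
-/

open Filter Finset Literature.MathematicalPhysics.QuantumLattice

/-- (A) one stair bounds `m` from above; all stairs below `h₀` bound it from below. -/
example (U μ ε h₀ : ℝ) (hh₀ : 0 < h₀) :
    (ε ≤ dWaveOrderParameter U μ ↔
      ∀ h ∈ Set.Ioo 0 h₀, ε ≤ liminf (fun L : ℕ => dWaveSourceDensity (L + 1) U μ h) atTop) ∧
    (∀ h, 0 < h → dWaveOrderParameter U μ ≤ liminf (fun L : ℕ => dWaveSourceDensity (L + 1) U μ h) atTop) :=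
  ⟨⟨fun hε _ hh => hε.trans (dWaveOrderParameter_le_liminf U μ hh.1),
    le_dWaveOrderParameter_of_forall U μ hh₀⟩,
   fun _ hh => dWaveOrderParameter_le_liminf U μ hh⟩

/-- (B) B₁g-orthogonality of any `A₁g`-symmetric weight on the finite momentum torus:
`Σ_{k ∈ L×L} (c k₁ - c k₂) · f (c k₁ + c k₂) ((c k₁ - c k₂)^2) = 0`. -/
theorem b1g_orthogonal_swap (L : ℕ) (c : Fin L → ℝ) (f : ℝ → ℝ → ℝ) :
    ∑ k : Fin L × Fin L, (c k.1 - c k.2) * f (c k.1 + c k.2) ((c k.1 - c k.2) ^ 2) = 0 := by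
  set S := ∑ k : Fin L × Fin L, (c k.1 - c k.2) * f (c k.1 + c k.2) ((c k.1 - c k.2) ^ 2) with hS
  have hswap : S = ∑ k : Fin L × Fin L,
      (c k.2 - c k.1) * f (c k.2 + c k.1) ((c k.2 - c k.1) ^ 2) := by
    rw [hS]
    exact (Fintype.sum_equiv (Equiv.prodComm (Fin L) (Fin L)) _ _ (fun k => rfl))
  have hneg : S = -S := by
    conv_rhs => rw [hswap]
    rw [hS, ← Finset.sum_neg_distrib]
    refine Finset.sum_congr rfl fun k _ => ?_
    have h1 : c k.2 + c k.1 = c k.1 + c k.2 := add_comm _ _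
    have h2 : (c k.2 - c k.1) ^ 2 = (c k.1 - c k.2) ^ 2 := by ring
    rw [h1, h2]; ring
  linarith

/-- (B') the instance used: the on-site anomalous average of the `d`-wave–sourced free gas vanishes,
`Σ_k ĝ_k · h/(2E_k) = 0` with `ĝ_k = 2√2 (cos k₁ - cos k₂)`, `E_k = √(ξ_k² + h² ĝ_k²)`,
`ξ_k = -2(cos k₁ + cos k₂) - μ` (tree normalisation of `pairField dWaveFormFactor`). -/
example (L : ℕ) (μ h : ℝ) :
    ∑ k : Fin L × Fin L,
      (2 * Real.sqrt 2 * (Real.cos (2 * Real.pi * k.1 / L) - Real.cos (2 * Real.pi * k.2 / L))) *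
        (h / (2 * Real.sqrt ((-2 * (Real.cos (2 * Real.pi * k.1 / L) + Real.cos (2 * Real.pi * k.2 / L)) - μ) ^ 2
          + h ^ 2 * (2 * Real.sqrt 2 * (Real.cos (2 * Real.pi * k.1 / L) - Real.cos (2 * Real.pi * k.2 / L))) ^ 2))) = 0 := by
  have key := b1g_orthogonal_swap L (fun i => Real.cos (2 * Real.pi * i / L))
    (fun s d => 2 * Real.sqrt 2 * (h / (2 * Real.sqrt ((-2 * s - μ) ^ 2 + h ^ 2 * (8 * d)))))
  rw [← key]
  refine Finset.sum_congr rfl fun k _ => ?_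
  have h8 : (2 * Real.sqrt 2 * (Real.cos (2 * Real.pi * ↑↑k.1 / ↑L) - Real.cos (2 * Real.pi * ↑↑k.2 / ↑L))) ^ 2
      = 8 * (Real.cos (2 * Real.pi * ↑↑k.1 / ↑L) - Real.cos (2 * Real.pi * ↑↑k.2 / ↑L)) ^ 2 := by
    rw [mul_pow, mul_pow, Real.sq_sqrt (by norm_num : (0:ℝ) ≤ 2)]; ring
  rw [h8]; ring

/-- (C) order-theoretic core of "SCI is a per-stair half-line": monotone `M`, SCI at `x`,
and a one-sided Lipschitz control of `η·M` along `[x, x']` propagate SCI to `x'`. -/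
example (M : ℝ → ℝ) (η g h x x' : ℝ)
    (sci : η * M (h + g * x) ≤ x) (hlip : η * (M (h + g * x') - M (h + g * x)) ≤ x' - x) :
    η * M (h + g * x') ≤ x' := by
  nlinarith [sci, hlip]
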